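import Mathlib

/-!
# Sketch (crux-ideate r2, ideator 4) — exact identities behind the negative notes `r2-ideator4-unused-levers.md`

No card is filed; these are the three elementary identities (L2, L3, L9 of the notes) stated over Mathlib so that a
disprover/prover can copy them. Proofs are NOT supplied here (sorry), except the ring identity behind L3.
-/

namespace Summit.Parity.GeneralizedHardyLittlewood.Cruxes.TableChowla.IdeaR2I4

open Finset

noncomputable section

/-- Liouville cast to `ℝ` at an integer argument (junk `0` below `1`, as in the route decl). -/
def lamZ (n : ℤ) : ℝ := (ArithmeticFunction.liouville (Int.toNat n) : ℝ)

/-- Row correlation of the shifted multiplication table: `T_c(a,a';B) = Σ_{b ≤ B} λ(ab+c) λ(a'b+c)`. -/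
def rowCorr (c : ℤ) (B a a' : ℕ) : ℝ :=
  ∑ b ∈ Icc 1 B, lamZ ((a : ℤ) * b + c) * lamZ ((a' : ℤ) * b + c)

/-- L3, the algebra behind the un-forced alignment: `a·(a'b + c) = a'·(ab + c) + c·(a − a')`. -/
theorem unforced_algebra (a a' b c : ℤ) : a * (a' * b + c) = a' * (a * b + c) + c * (a - a') := by ring

/-- L3 (un-forced alignment, level `σ`): for `a ≥ 1` and entries `≥ 1`,
`T_c(a,a';B) = λ(a) · Σ_{b ≤ B} λ(ab+c) · λ(a'(ab+c) + c(a−a'))`, i.e. with `m = ab + c ≡ c (mod a)` the second factor is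
`λ(a' m + c(a−a'))` — modulus `a` only, dilation `a'`, shift `c(a − a')`. (Uses complete multiplicativity
`λ(a·y) = λ(a)λ(y)` and `unforced_algebra`.) -/
theorem rowCorr_unforced (c : ℤ) (B a a' : ℕ) (ha : 1 ≤ a)
    (hpos : ∀ b ∈ Icc 1 B, 1 ≤ (a : ℤ) * b + c ∧ 1 ≤ (a' : ℤ) * b + c) :
    rowCorr c B a a' =
      lamZ a * ∑ b ∈ Icc 1 B, lamZ ((a : ℤ) * b + c) * lamZ ((a' : ℤ) * ((a : ℤ) * b + c) + c * ((a : ℤ) - a')) := by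
  sorry

/-- L2 (prime-multiple identity, column form): for a prime `p`,
`T_c(a,a';B) = Σ_{b'' ≤ pB, p ∣ b''} λ(a b'' + p c) λ(a' b'' + p c)` (since `λ(p(ab+c)) = −λ(ab+c)` twice). -/
theorem rowCorr_prime_multiple (c : ℤ) (B a a' p : ℕ) (hp : p.Prime)
    (hpos : ∀ b ∈ Icc 1 B, 1 ≤ (a : ℤ) * b + c ∧ 1 ≤ (a' : ℤ) * b + c) :
    rowCorr c B a a' =
      ∑ b'' ∈ (Icc 1 (p * B)).filter (fun b'' => p ∣ b''),
        lamZ ((a : ℤ) * b'' + p * c) * lamZ ((a' : ℤ) * b'' + p * c) := by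
  sorry

/-- L9 (row anatomy descent): the bilinear form of the `(A,B)` table restricted to rows divisible by `d` is a bilinear form of
the `(A/d, dB)` table (same `x = AB`, same `c`) against the column vector spread to multiples of `d`:
`Σ_{a₁ ∈ (A/d, 2A/d]} Σ_{b ≤ B} u(d a₁) v(b) λ(d a₁ b + c) = Σ_{a₁} Σ_{b' ≤ dB, d ∣ b'} u(d a₁) v(b'/d) λ(a₁ b' + c)`. -/
theorem descent_rows_divisible (c : ℤ) (A B d : ℕ) (hd : 1 ≤ d) (u v : ℕ → ℝ) :
    (∑ a₁ ∈ Ioc (A / d) (2 * A / d), ∑ b ∈ Icc 1 B, u (d * a₁) * v b * lamZ ((d : ℤ) * a₁ * b + c)) =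
      ∑ a₁ ∈ Ioc (A / d) (2 * A / d), ∑ b' ∈ (Icc 1 (d * B)).filter (fun b' => d ∣ b'),
        u (d * a₁) * v (b' / d) * lamZ ((a₁ : ℤ) * b' + c) := by
  sorry

end

end Summit.Parity.GeneralizedHardyLittlewood.Cruxes.TableChowla.IdeaR2I4
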